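import Summits.BirchSwinnertonDyer.Rank1Residual.X2.IMCEqOnTreeIntOther
import Summits.BirchSwinnertonDyer.BirchSwinnertonDyer.Theorems.EisensteinPrimesXAcImprimitiveLambdaShift
import Literature.NumberTheory.EllipticCurves.Castella2018.AnticyclotomicSelmerDualModuleFinite
import Literature.NumberTheory.EllipticCurves.KellerYin2024.MultiplicativeImprimitiveMuInvariant
import HarnessLib

/-!
# Crux 4 `BSDpOnCellC` (stmt-BirchSwinnertonDyer-19034), line b1: the SELMER HALF of the «μ = 0 pair»
# BY NAME — Keller–Yin v2 Lemma 5.1.1 (`μ(𝔛^S_f) = 0` at a multiplicative Eisenstein prime, weight-2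
# part) typed as a named OPEN fact, and `μ(X_ac^∅(E_K[p^∞]) strict at 𝔭̄) = 0` at every X2c Heegner
# datum, both signs, derived from it in the kernel (cell `bsd-eis`, seat `bsd-line-x2-p2` gen 3,
# D-0154 KEY row 5; route `EisensteinPrimes`; companions p613384, p564629, p620653)

HONEST FRAMING (cell `bsd-eis`, run/shared/lean/pub/bsd-eis/): ONE hypothesis-shaped named fact
(`def … : Prop`, an UNREFEREED PREPRINT claim, `[claim: KellerYin2024, status: under-review]`, to be
taken as `(h : …_OPEN)`) + kernel bookkeeping; CONDITIONAL results; nothing about any curve is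
asserted; nothing booked; X2 stays CONSTRUCTION-SHAPED; no label or count moves; BSD and the main
conjectures are proved for NO curve. Helper attached to stmt-BirchSwinnertonDyer-19034 (`--supports`);
it closes no registered stub (skeleton of record b1 v10 f17b408e: `stub_publishedFacts`, `stub_c3`,
`stub_mazurMC_cellB`); it proves, CONDITIONALLY on the named fact, the signature of the DRAFT re-cut
v11's `stub_muSelmer` (host guidance (α), STATUS l.2647 / l.2672; draft sha256 7a228e3b96402e74).

## Why

Seat g2's `BSDpOnCellCResidualPub` (p613384) prices crux 4 on line b1 at the published tier as
[17 PUB] + [crux 3] + [road R-β at `𝔭̄`] + at every X2c datum the INLINE data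
«`μ(X_ac^∅ strict at 𝔭̄) = 0` ∧ `∃ m ≤ λ(X_ac^∅)`, the frame `Q` has its first unit coefficient at `m`»,
citing for `μ = 0` "Keller–Yin §5.1 μ-Lemma". This file NAMES that input as Keller–Yin print it and
derives the datum statement from the name:

* INPUT (Literature, typed by this seat, p621903): `KellerYin2024.lemma511_imprimitive_isTorsion_muInvariant_eq_zero_mult_OPEN`
  (`Literature/…/KellerYin2024/MultiplicativeImprimitiveMuInvariant.lean`) — Keller–Yin
  arXiv:2402.12781v2 §5.1 **Lemma 5.1.1** (TeX L1744–1749; v1 Lemma 5.0.2): "The `μ`-invariants of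
  `𝔛^S_f` and `𝔛^S_{f_m}` are `0`", member-`f` half, transcribed as «`X^{Sf}` is `Λ`-torsion ∧
  `μ(X^{Sf}) = 0`» for `X^{Sf} = AcSelmer.XAc (W.baseChange K) p κ vbar ↑Sf γ`, `Sf` = the places of `K`
  over `N_E` NOT over `p` (KY's `S = Σ ∖ {v, v̄, ∞}` at the minimal `Σ`); flags KY511-S / KYD-Sel /
  KY511-tors / KY511-h1 in that file.
* §1 `isTorsion_muInvariant_eq_zero_empty_of_imprimitive` — kernel: `μ(X^∅) = 0` (and torsion, and
  `λ(X^{Sf}) = λ(X^∅) + corank(Sel^{Sf}/Sel^∅)`) from the `Sf`-imprimitive torsion + `μ = 0`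
  (`XAcImprimitiveLambdaShift.lambdaInvariant_eq_add_zpCorank_of_muInvariant_eq_zero`, p564629, with
  Castella's finite generation `AcSelmer.XAc.module_finite`); `exists_finset_offP` — the finite set `Sf`.
* §2 **`stub_muSelmer_of_lemma511_OPEN`** — the v11-draft stub `stub_muSelmer` VERBATIM (both signs:
  at every X2c Heegner datum with `d_K` odd, binders of `X2.Nonsplit/SplitIMCEqOnTreeIntOther`,
  `muInvariant p (XAc (W.baseChange K) p κ 𝔭bar ∅ γ) = 0`) from §0 BY NAME (`CellC` gives `p ≠ 2`,
  `Red`, `Mult`; `d_K < −4` gives `d_K ≠ −3`; `N = N_E`; `(p)` split; `𝔭̄ ∋ p`).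
* (companion file `…StubC3MultMuLemmaResidual`): p613384's inline datum hypotheses with their
  `μ`-conjunct DISCHARGED by name, and the crux BY NAME with this one input named.

What this is NOT: not a proof of Lemma 5.1.1 (the Greenberg–Vatsal/Keller–Yin devissage along
`0 → 𝔽(φ) → E[p] → 𝔽(ψ) → 0` for the imprimitive Selmer group is not in the tree); not a
re-registration of the skeleton.

References: [KellerYin2024] §5 standing (TeX L1718–1722), §5.1 (L1725–1735), Lemma 5.1.1 (L1744–1749),
Thm. 1.4.1 (L1087–1098); [Castella2018] Def. 2.2; [CastellaGrossiLeeSkinner2022] §2.3 (`𝔛_E`);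
[GreenbergVatsal2000] §2 Cor. (2.3), p. 21; cell: RESIDUAL-MAP-crux4-b1.md, v11 draft (evidence #45).
-/

set_option autoImplicit false
set_option linter.dupNamespace false -- the summit namespace `…BirchSwinnertonDyer.BirchSwinnertonDyer.Theorems` (Sub = Summit, D-0017) trips it

noncomputable section

open scoped Classical MatrixGroups ModularForm

open CongruenceSubgroup WeierstrassCurve NumberField IsDedekindDomain Field PowerSeries
  Literature.NumberTheory.EllipticCurves Literature.NumberTheory.EllipticCurves.GreenbergSelmer
  Literature.NumberTheory.EllipticCurves.ModularForms
  Literature.NumberTheory.EllipticCurves.Rank1Residual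
  Literature.NumberTheory.EllipticCurves.Rank1Residual.Typed
  Literature.NumberTheory.GaloisRepresentations Literature.NumberTheory.GaloisCohomology
  Literature.NumberTheory.Automorphic
  Summit.BirchSwinnertonDyer.Rank1Residual.X11b.AcSelmer
  Summit.BirchSwinnertonDyer.Rank1Residual.X11b.Halves
  Summit.BirchSwinnertonDyer.Rank1Residual.X11b
  Summit.BirchSwinnertonDyer.Rank1Residual Summit.BirchSwinnertonDyer.Rank1Residual.X2

open Literature.NumberTheory.EllipticCurves.KellerYin2024

namespace Summit.BirchSwinnertonDyer.BirchSwinnertonDyer.Theorems.StubC3MultMuLemma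

/-! ### §1 Kernel: from the `Sf`-imprimitive dual to the primitive one -/

section Kernel

variable {K : Type} [Field K] [NumberField K] {p : ℕ} [Fact p.Prime]

/-- The finite set of places of `K` over `N ≠ 0` and NOT over `p` exists (prime factors of `(N)`,
filtered). [folklore] -/
theorem exists_finset_offP {N : ℕ} (hN : N ≠ 0) (p : ℕ) :
    ∃ Sf : Finset (HeightOneSpectrum (𝓞 K)), ∀ w : HeightOneSpectrum (𝓞 K), w ∈ Sf ↔
      (((N : ℤ) : 𝓞 K) ∈ w.asIdeal ∧ ((p : ℕ) : 𝓞 K) ∉ w.asIdeal) := by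
  have hI : (Ideal.span {((N : ℤ) : 𝓞 K)} : Ideal (𝓞 K)) ≠ 0 := by
    rw [Ne, Ideal.zero_eq_bot, Ideal.span_singleton_eq_bot]
    exact_mod_cast hN
  refine ⟨(Ideal.finite_factors hI).toFinset.filter (fun w ↦ ((p : ℕ) : 𝓞 K) ∉ w.asIdeal),
    fun w ↦ ?_⟩
  rw [Finset.mem_filter, Set.Finite.mem_toFinset, Set.mem_setOf_eq, Ideal.dvd_span_singleton]

/-- **`X^∅` is `Λ`-torsion with `μ(X^∅) = 0`, and `λ(X^{Sf}) = λ(X^∅) + corank_{ℤ_p}(Sel^{Sf}/Sel^∅)`,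
as soon as the `Sf`-imprimitive dual `X^{Sf}` is `Λ`-torsion with `μ = 0`** (Castella's
`X_ac^Σ(E[p^∞])`, any elliptic `W/K`, any `ℤ_p`-extension with topological generator, any `𝔭`, any
finite `Sf`): `XAcImprimitiveLambdaShift.lambdaInvariant_eq_add_zpCorank_of_muInvariant_eq_zero`
(p564629) at `∅ ⊆ Sf`, the finite generation of `X^{Sf}` being Castella's (`Castella2018.AcSelmer.XAc.module_finite`).
[cite: GreenbergVatsal2000, §2 Cor. (2.3) and p. 21 (arXiv:math/9906215 pp. 20–21)]
[cite: Castella2018, §2.1 Def. 2.2 (arXiv:1704.06608 p. 5)] -/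
theorem isTorsion_muInvariant_eq_zero_empty_of_imprimitive
    (W : WeierstrassCurve K) [W.IsElliptic] (κ : ZpExtension K p) (𝔭 : HeightOneSpectrum (𝓞 K))
    (γ : absoluteGaloisGroup K) [Fact (κ.IsTopGenerator γ)] (Sf : Finset (HeightOneSpectrum (𝓞 K)))
    (htor : Module.IsTorsion (IwasawaAlgebra p)
      (Castella2018.AcSelmer.XAc W p κ 𝔭 (↑Sf : Set (HeightOneSpectrum (𝓞 K))) γ))
    (hμ : muInvariant p (Castella2018.AcSelmer.XAc W p κ 𝔭 (↑Sf : Set (HeightOneSpectrum (𝓞 K))) γ) = 0) :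
    Module.IsTorsion (IwasawaAlgebra p) (Castella2018.AcSelmer.XAc W p κ 𝔭 ∅ γ) ∧
      muInvariant p (Castella2018.AcSelmer.XAc W p κ 𝔭 ∅ γ) = 0 ∧
      lambdaInvariant p (Castella2018.AcSelmer.XAc W p κ 𝔭 (↑Sf : Set (HeightOneSpectrum (𝓞 K))) γ) =
        lambdaInvariant p (Castella2018.AcSelmer.XAc W p κ 𝔭 ∅ γ) +
          zpCorank (↥(Castella2018.AcSelmer.selmerAc W p κ 𝔭 (↑Sf : Set (HeightOneSpectrum (𝓞 K)))) ⧸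
            (Castella2018.AcSelmer.selmerAc W p κ 𝔭 (∅ : Set (HeightOneSpectrum (𝓞 K)))).addSubgroupOf
              (Castella2018.AcSelmer.selmerAc W p κ 𝔭 (↑Sf : Set (HeightOneSpectrum (𝓞 K))))) p := by
  haveI : Module.Finite (IwasawaAlgebra p)
      (Castella2018.AcSelmer.XAc W p κ 𝔭 (↑Sf : Set (HeightOneSpectrum (𝓞 K))) γ) :=
    Castella2018.AcSelmer.XAc.module_finite W p κ 𝔭 _ γ (Finset.finite_toSet Sf)
  obtain ⟨-, htor₀, hμ₀, -, hlam⟩ :=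
    XAcImprimitiveLambdaShift.lambdaInvariant_eq_add_zpCorank_of_muInvariant_eq_zero W p κ 𝔭 γ
      (Set.empty_subset (↑Sf : Set (HeightOneSpectrum (𝓞 K)))) htor hμ
  exact ⟨htor₀, hμ₀, hlam⟩

/-- **At an X2c-type datum, Lemma 5.1.1 BY NAME gives `μ(X_ac^∅ strict at 𝔭̄) = 0` (and torsion).**
Inputs: the named fact; `2 < p`, `Mult`, `Red`; `K` imaginary quadratic, (Heeg) for `N_E`, `d_K` odd,
`d_K ≠ −3`, `(p)` split, `𝔭̄ ∋ p`; `κ` anticyclotomic with topological generator `γ`. The finite set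
`Sf` of §0 is supplied by `exists_finset_offP`. CONDITIONAL on the OPEN fact; nothing asserted.
[claim: KellerYin2024, status: under-review]
[cite: KellerYin2024, Lemma 5.1.1 (arXiv:2402.12781v2 §5.1 TeX L1744–1749)] -/
theorem isTorsion_muInvariant_eq_zero_empty_of_lemma511_OPEN
    (h511 : lemma511_imprimitive_isTorsion_muInvariant_eq_zero_mult_OPEN)
    (W : WeierstrassCurve ℚ) [W.IsElliptic] [W.IsGloballyMinimal] (hp : 2 < p) (hmult : Mult W p)
    (hred : Red W p) (hK : IsImaginaryQuadratic K)
    (hH : SatisfiesHeegnerHypothesis (W.conductorNorm ℤ) K) (hodd : Odd (NumberField.discr K))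
    (h3 : NumberField.discr K ≠ -3) (hsplit : ((Ideal.span {(p : ℤ)}).primesOver (𝓞 K)).ncard = 2)
    (vbar : HeightOneSpectrum (𝓞 K)) (hvbar : ((p : ℕ) : 𝓞 K) ∈ vbar.asIdeal)
    (κ : ZpExtension K p) (hκ : κ.IsAnticyclotomic) (γ : absoluteGaloisGroup K)
    [Fact (κ.IsTopGenerator γ)] :
    Module.IsTorsion (IwasawaAlgebra p) (Castella2018.AcSelmer.XAc (W.baseChange K) p κ vbar ∅ γ) ∧
      muInvariant p (Castella2018.AcSelmer.XAc (W.baseChange K) p κ vbar ∅ γ) = 0 := by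
  haveI : (W.baseChange K).IsElliptic := by rw [WeierstrassCurve.baseChange]; infer_instance
  have hN0 : W.conductorNorm ℤ ≠ 0 := (W.conductorNorm_pos_holds).ne'
  obtain ⟨Sf, hSf⟩ := exists_finset_offP (K := K) hN0 p
  obtain ⟨htor, hμ⟩ := h511 W K vbar κ γ Sf hp hmult hred hK hH hodd h3 hsplit hvbar hκ hSf
  obtain ⟨htor₀, hμ₀, -⟩ :=
    isTorsion_muInvariant_eq_zero_empty_of_imprimitive (W.baseChange K) κ vbar γ Sf htor hμ
  exact ⟨htor₀, hμ₀⟩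

end Kernel

/-! ### §2 The v11-draft stub `stub_muSelmer` VERBATIM, from Lemma 5.1.1 BY NAME -/

/-- **`stub_muSelmer` (re-cut draft b1 v11, sha256 7a228e3b…) from Keller–Yin Lemma 5.1.1 BY NAME**:
at every X2c Heegner datum with `d_K` odd (binders of `X2.NonsplitIMCEqOnTreeIntOther` /
`X2.SplitIMCEqOnTreeIntOther` VERBATIM), both signs, `μ(X_ac^∅(E_K[p^∞]) strict at 𝔭̄) = 0`.
From the datum: `CellC` ⇒ `p ≠ 2`, `Red`, `Mult`; `d_K < −4` ⇒ `d_K ≠ −3`; `N = N_E`; `(p)` split;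
`𝔭̄ ∋ p`; then §1. CONDITIONAL on the OPEN fact; nothing booked; closes no registered stub of v10.
[claim: KellerYin2024, status: under-review]
[cite: KellerYin2024, Lemma 5.1.1 (arXiv:2402.12781v2 §5.1 TeX L1744–1749)]
[cite: Castella2018, Def. 2.2 (arXiv:1704.06608 p. 5)] -/
theorem stub_muSelmer_of_lemma511_OPEN
    (h511 : lemma511_imprimitive_isTorsion_muInvariant_eq_zero_mult_OPEN) :
    (∀ (W : WeierstrassCurve ℚ) [W.IsElliptic] [W.IsGloballyMinimal] (p : ℕ) [Fact p.Prime],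
      ∀ (N : ℕ) [NeZero N] (K : Type) [Field K] [NumberField K] (Dt : ModularParametrizationData W N)
        (H : HeegnerDatum N (NumberField.discr K)) (ιK : K →+* ℂ) (P : (W.baseChange K).toAffine.Point),
        CellC W p → ¬ W.HasSplitMultiplicativeReductionAtPrime p → W.conductorNorm ℤ = N →
        IsImaginaryQuadratic K → NumberField.discr K < -4 → SatisfiesHeegnerHypothesis N K →
        (W.quadraticTwist (NumberField.discr K : ℚ)).entireLFunction 1 ≠ 0 →
        WeierstrassCurve.Affine.Point.map ιK.toRatAlgHom P = heegnerPointComplex Dt H →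
        ¬ (p : ℤ) ∣ Dt.c → ¬ IsOfFinAddOrder P →
        Odd (NumberField.discr K) →
        ∀ (κ : ZpExtension K p), κ.IsAnticyclotomic →
          ∀ (γ : Field.absoluteGaloisGroup K) [Fact (κ.IsTopGenerator γ)]
            (𝔭 : HeightOneSpectrum (𝓞 K)), ((p : ℕ) : 𝓞 K) ∈ 𝔭.asIdeal →
            𝔭.asIdeal.ramificationIdx (𝓞 ℚ) = 1 → 𝔭.asIdeal.inertiaDeg (𝓞 ℚ) = 1 →
            ∀ (𝔭bar : HeightOneSpectrum (𝓞 K)), ((p : ℕ) : 𝓞 K) ∈ 𝔭bar.asIdeal → 𝔭bar ≠ 𝔭 →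
              ((Ideal.span {(p : ℤ)}).primesOver (𝓞 K)).ncard = 2 →
            ∀ (f : CuspForm (CongruenceSubgroup.Gamma0 N) 2), IsNewformOf W f →
              ∀ (ι' : PadicAlgCl p ≃+* ℂ),
                (∀ (w : InfinitePlace K) (k : 𝓞 K),
                  k ∈ 𝔭.asIdeal ↔ ‖ι'.symm (w.embedding (k : K))‖ < 1) →
                ∀ (ΩK : ℂ) (Ωp : ℂ_[p]) (Q : PowerSeries 𝓞_ℂ_[p]), ΩK ≠ 0 → ‖Ωp‖ = 1 →
                  R1.IsBDPLFunctionInt p ι' 𝔭 κ γ f ΩK Ωp Q →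
                    muInvariant p (XAc (W.baseChange K) p κ 𝔭bar ∅ γ) = 0) ∧
    (∀ (W : WeierstrassCurve ℚ) [W.IsElliptic] [W.IsGloballyMinimal] (p : ℕ) [Fact p.Prime],
      ∀ (N : ℕ) [NeZero N] (K : Type) [Field K] [NumberField K] (Dt : ModularParametrizationData W N)
        (H : HeegnerDatum N (NumberField.discr K)) (ιK : K →+* ℂ) (P : (W.baseChange K).toAffine.Point),
        CellC W p → W.HasSplitMultiplicativeReductionAtPrime p → W.conductorNorm ℤ = N →
        IsImaginaryQuadratic K → NumberField.discr K < -4 → SatisfiesHeegnerHypothesis N K →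
        (W.quadraticTwist (NumberField.discr K : ℚ)).entireLFunction 1 ≠ 0 →
        WeierstrassCurve.Affine.Point.map ιK.toRatAlgHom P = heegnerPointComplex Dt H →
        ¬ (p : ℤ) ∣ Dt.c → ¬ IsOfFinAddOrder P →
        Odd (NumberField.discr K) →
        ∀ (κ : ZpExtension K p), κ.IsAnticyclotomic →
          ∀ (γ : Field.absoluteGaloisGroup K) [Fact (κ.IsTopGenerator γ)]
            (𝔭 : HeightOneSpectrum (𝓞 K)), ((p : ℕ) : 𝓞 K) ∈ 𝔭.asIdeal →
            𝔭.asIdeal.ramificationIdx (𝓞 ℚ) = 1 → 𝔭.asIdeal.inertiaDeg (𝓞 ℚ) = 1 →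
            ∀ (𝔭bar : HeightOneSpectrum (𝓞 K)), ((p : ℕ) : 𝓞 K) ∈ 𝔭bar.asIdeal → 𝔭bar ≠ 𝔭 →
              ((Ideal.span {(p : ℤ)}).primesOver (𝓞 K)).ncard = 2 →
            ∀ (f : CuspForm (CongruenceSubgroup.Gamma0 N) 2), IsNewformOf W f →
              ∀ (ι' : PadicAlgCl p ≃+* ℂ),
                (∀ (w : InfinitePlace K) (k : 𝓞 K),
                  k ∈ 𝔭.asIdeal ↔ ‖ι'.symm (w.embedding (k : K))‖ < 1) →
                ∀ (ΩK : ℂ) (Ωp : ℂ_[p]) (Q : PowerSeries 𝓞_ℂ_[p]), ΩK ≠ 0 → ‖Ωp‖ = 1 →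
                  R1.IsBDPLFunctionInt p ι' 𝔭 κ γ f ΩK Ωp Q →
                    muInvariant p (XAc (W.baseChange K) p κ 𝔭bar ∅ γ) = 0) := by
  refine ⟨fun W _ _ p _ N _ K _ _ Dt H ιK P hc _ hN hK hd4 hHN _ _ _ _ hodd κ hκ γ _ 𝔭 _ _ _ 𝔭bar
      h𝔭bar _ hsplit _ _ _ _ _ _ _ _ _ _ ↦ ?_,
    fun W _ _ p _ N _ K _ _ Dt H ιK P hc _ hN hK hd4 hHN _ _ _ _ hodd κ hκ γ _ 𝔭 _ _ _ 𝔭bar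
      h𝔭bar _ hsplit _ _ _ _ _ _ _ _ _ _ ↦ ?_⟩ <;>
  · have hp2 : 2 < p := by
      have hp := (Fact.out : p.Prime).two_le
      rcases hp.lt_or_eq with h | h
      · exact h
      · exact absurd h.symm hc.2.1
    have h3 : NumberField.discr K ≠ -3 := by omega
    exact (isTorsion_muInvariant_eq_zero_empty_of_lemma511_OPEN h511 W hp2 hc.2.2.2 hc.2.2.1 hK
      (hN ▸ hHN) hodd h3 hsplit 𝔭bar h𝔭bar κ hκ γ).2

end Summit.BirchSwinnertonDyer.BirchSwinnertonDyer.Theorems.StubC3MultMuLemma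

end
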